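import Mathlib
import HarnessLib
import Summits.Ventures.LatticeQCDFlow.Scaling.TorusRankedIntegerSpan

/-!
# LatticeQCDFlow / Scaling — abelian holonomy determination: along a full ranked structure of
# `(ℤ/L)^d` every plaquette holonomy of an ABELIAN gauge field is a Laurent monomial in the covered
# holonomies — the exact heat-bath autoregression leaves no fresh randomness to the uncovered plaquettes

HONEST FRAMING: exact (Metropolis-corrected) sampling algorithms for lattice gauge theory;
figures of merit are autocorrelation/cost numbers at stated couplings and volumes; no
continuum-physics claim.

Venture `LatticeQCDFlow` (cell pub-lqcd), topic `Scaling`, FANOUT row 30 (lean-1, GEN-27) — OUR WORK on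
THEORY-2.md §4 row C5 (gen25 Q2, the consequence for the sampler).  A collection `B` of plaquettes of
`(ℤ/L)^d` RANKED for a top-link assignment `t` (`t p` a link of `p`; `rank p < rank p'` whenever `t p` lies
on another `p' ∈ B`) carries an exact one-plaquette heat-bath autoregression whose law makes the covered
holonomies `U_p`, `p ∈ B`, INDEPENDENT heat-bath variables (`Scaling/AutoregressiveGaugeHeatBathRanked`);
the `k = #Bᶜ ≥ k_min(d, L)` uncovered plaquettes ride on the Metropolis step.  `Scaling/TorusRankedIntegerSpan`
proved that for a FULL ranked `B` (`#B = (d−1)(L^d − 1)`, e.g. every optimal one) every integer 1-chain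
with zero divergence and zero winding is `Σ_{p∈B} c_p σ∂p` with unique integers `c_p`.  For a gauge field
with values in a COMMUTATIVE group `G` this is a statement about holonomies:

* §1 integer chains act on abelian configurations: `U^v := ∏_e U(e)^{v(e)}` is additive in `v`
  (`prod_zpow_add`, `prod_zpow_neg`, `prod_zpow_single`, **`prod_zpow_sum_smul`**:
  `U^{Σ c_i v_i} = ∏_i (U^{v_i})^{c_i}`);
* §2 **`plaquetteHolonomy_eq_prod_zpow`** — for commutative `G` the plaquette holonomy
  `U(x,i) U(x+e_i,j) U(x+e_j,i)⁻¹ U(x,j)⁻¹` IS `U^{σ∂p}`;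
* §3 **`exists_prod_zpow_eq_prod_plaquetteHolonomy_zpow`** — ABELIAN STOKES ON THE COVERED BASIS: for a full
  ranked `B` and every integer chain `v` with zero divergence and zero winding (every contractible closed
  lattice loop, e.g.) there are integers `c_p`, INDEPENDENT OF THE CONFIGURATION, with
  `U^v = ∏_{p∈B} U_p^{c_p}` for every `U`; in particular **`exists_plaquetteHolonomy_eq_prod_zpow`** —
  EVERY PLAQUETTE HOLONOMY IS A LAURENT MONOMIAL `U_{p'} = ∏_{p∈B} U_p^{c_p}` IN THE COVERED ONES (and
  `…_of_optimal`: the same for every optimal structure, `#Bᶜ = k_min(d, L)`);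
* §4 **`plaquetteHolonomy_eq_of_covered_eq`** — DETERMINATION: two abelian configurations with the same
  covered holonomies have the same holonomy around EVERY plaquette, hence the same plaquette weight
  products over any set of plaquettes (**`prod_weight_eq_of_covered_eq`**) — the uncovered factor
  `F_R = ∏_{p∉B} w(U_p)` of the importance ratio of the exact sampler is a FUNCTION OF THE COVERED
  HOLONOMIES: along a full ranked structure the heat-bath autoregression of an abelian lattice gauge field
  leaves no randomness to the plaquettes it does not cover;
* §5 the one relation that needs no structure: the signed boundaries of ALL plaquettes sum to zero
  (**`sum_signedBoundary_eq_zero`**), so for commutative `G` all plaquette holonomies multiply to `1`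
  (**`prod_plaquetteHolonomy_univ_eq_one`**) and any one is the inverse product of the others
  (**`plaquetteHolonomy_eq_inv_prod_erase_anyDim`**) — in TWO dimensions (`k_min = 1`, the comb) this IS the whole
  determination, every exponent `−1`; in `d ≥ 3` it is one relation among the `k_min(d, L)` of §3.

Not claimed: anything for non-abelian `G` (there the uncovered holonomies are NOT functions of the covered
ones in general); any distributional statement about the monomials.  No `def`, no `sorry`, nothing cited as
a fact beyond the tree.
-/

namespace Summit.Ventures.LatticeQCDFlow.Theory2.Autoregressive

open Finset
open Literature.MathematicalPhysics.QuantumFieldTheory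

variable {d L : ℕ} [NeZero L] {G : Type*} [CommGroup G]

/-! ## §1 Integer chains act on abelian configurations -/

/-- `U^{v+w} = U^v · U^w`. [ours] -/
theorem prod_zpow_add (U : GaugeConfig d L G) (v w : Edge d L → ℤ) :
    ∏ e, U e ^ (v + w) e = (∏ e, U e ^ v e) * ∏ e, U e ^ w e := by
  rw [← Finset.prod_mul_distrib]
  exact Finset.prod_congr rfl fun e _ => by rw [Pi.add_apply, zpow_add]

/-- `U^{−v} = (U^v)⁻¹`. [ours] -/
theorem prod_zpow_neg (U : GaugeConfig d L G) (v : Edge d L → ℤ) :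
    ∏ e, U e ^ (-v) e = (∏ e, U e ^ v e)⁻¹ := by
  rw [← Finset.prod_inv_distrib]
  exact Finset.prod_congr rfl fun e _ => by rw [Pi.neg_apply, zpow_neg]

/-- `U^{v−w} = U^v · (U^w)⁻¹`. [ours] -/
theorem prod_zpow_sub (U : GaugeConfig d L G) (v w : Edge d L → ℤ) :
    ∏ e, U e ^ (v - w) e = (∏ e, U e ^ v e) * (∏ e, U e ^ w e)⁻¹ := by
  rw [sub_eq_add_neg, prod_zpow_add, prod_zpow_neg]

/-- `U^{n·𝟙_e₀} = U(e₀)^n`. [ours] -/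
theorem prod_zpow_single (U : GaugeConfig d L G) (e₀ : Edge d L) (n : ℤ) :
    ∏ e, U e ^ (Pi.single e₀ n : Edge d L → ℤ) e = U e₀ ^ n := by
  classical
  rw [Finset.prod_eq_single e₀]
  · rw [Pi.single_eq_same]
  · intro e _ he
    rw [Pi.single_eq_of_ne he, zpow_zero]
  · intro h; exact absurd (Finset.mem_univ e₀) h

/-- `U^{c·v} = (U^v)^c`. [ours] -/
theorem prod_zpow_smul (U : GaugeConfig d L G) (c : ℤ) (v : Edge d L → ℤ) :
    ∏ e, U e ^ (c • v) e = (∏ e, U e ^ v e) ^ c := by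
  rw [← Finset.prod_zpow]
  exact Finset.prod_congr rfl fun e _ => by rw [Pi.smul_apply, smul_eq_mul, mul_comm, zpow_mul]

/-- **`U^{Σ_i c_i v_i} = ∏_i (U^{v_i})^{c_i}`** — integer combinations of chains become Laurent monomials.
[ours] -/
theorem prod_zpow_sum_smul {ι : Type*} (U : GaugeConfig d L G) (s : Finset ι) (c : ι → ℤ)
    (v : ι → Edge d L → ℤ) :
    ∏ e, U e ^ (∑ i ∈ s, c i • v i) e = ∏ i ∈ s, (∏ e, U e ^ v i e) ^ c i := by
  classical
  induction s using Finset.induction_on with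
  | empty => simp
  | insert a s ha ih =>
    rw [Finset.sum_insert ha, Finset.prod_insert ha, prod_zpow_add, prod_zpow_smul, ih]

/-! ## §2 The plaquette holonomy of an abelian field is `U^{σ∂p}` -/

/-- **For commutative `G`, `U_p = U(x,i) U(x+e_i,j) U(x+e_j,i)⁻¹ U(x,j)⁻¹ = ∏_e U(e)^{σ∂p(e)}`** with the
signed boundary `σ∂p = 𝟙_{(x,i)} + 𝟙_{(x+e_i,j)} − 𝟙_{(x+e_j,i)} − 𝟙_{(x,j)}` of `Scaling/TorusSignedBoundary`.
[ours] -/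
theorem plaquetteHolonomy_eq_prod_zpow (U : GaugeConfig d L G) (p : Plaquette d L) :
    plaquetteHolonomy U p.1 p.2.1.1 p.2.1.2 =
      ∏ e, U e ^ (Pi.single (p.1, p.2.1.1) 1 + Pi.single (p.1.shift p.2.1.1, p.2.1.2) 1 -
        Pi.single (p.1.shift p.2.1.2, p.2.1.1) 1 - Pi.single (p.1, p.2.1.2) 1 : Edge d L → ℤ) e := by
  rw [prod_zpow_sub, prod_zpow_sub, prod_zpow_add, prod_zpow_single, prod_zpow_single, prod_zpow_single,
    prod_zpow_single, zpow_one, zpow_one, zpow_one, zpow_one]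
  rfl

/-! ## §3 Abelian Stokes on the covered basis -/

/-- **ABELIAN STOKES ON THE COVERED BASIS.**  `L ≥ 2`; `(B, t, rank)` ranked and full
(`#B = (d−1)(L^d − 1)`); `G` commutative.  For every integer chain `v` with zero divergence and zero winding
there are integers `c_p` — the same for every configuration — with `∏_e U(e)^{v(e)} = ∏_{p∈B} U_p^{c_p}`.
[ours] -/
theorem exists_prod_zpow_eq_prod_plaquetteHolonomy_zpow (hL : 2 ≤ L) (B : Finset (Plaquette d L))
    (t : Plaquette d L → Edge d L)
    (ht : ∀ p ∈ B, t p ∈ ({(p.1, p.2.1.1), (p.1.shift p.2.1.1, p.2.1.2),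
        (p.1.shift p.2.1.2, p.2.1.1), (p.1, p.2.1.2)} : Finset (Edge d L)))
    (rank : Plaquette d L → ℕ)
    (hrank : ∀ p ∈ B, ∀ p' ∈ B, p ≠ p' → t p ∈ ({(p'.1, p'.2.1.1), (p'.1.shift p'.2.1.1, p'.2.1.2),
        (p'.1.shift p'.2.1.2, p'.2.1.1), (p'.1, p'.2.1.2)} : Finset (Edge d L)) → rank p < rank p')
    (hcard : B.card = (d - 1) * (L ^ d - 1)) (v : Edge d L → ℤ)
    (hdiv : (fun y : Site d L => ∑ i : Fin d, (v (y, i) - v (y - Pi.single i 1, i))) = 0)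
    (hwind : (fun m : Fin d => ∑ x ∈ (Finset.univ.filter fun x : Site d L => x m = 0), v (x, m)) = 0) :
    ∃ c : Plaquette d L → ℤ, ∀ U : GaugeConfig d L G,
      ∏ e, U e ^ v e = ∏ p ∈ B, (plaquetteHolonomy U p.1 p.2.1.1 p.2.1.2) ^ c p := by
  obtain ⟨c, hc⟩ := exists_eq_sum_smul_signedBoundary hL B t ht rank hrank hcard v hdiv hwind
  refine ⟨c, fun U => ?_⟩
  rw [hc, prod_zpow_sum_smul]
  exact Finset.prod_congr rfl fun p _ => by rw [plaquetteHolonomy_eq_prod_zpow]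

/-- **EVERY PLAQUETTE HOLONOMY IS A LAURENT MONOMIAL IN THE COVERED ONES.**  `L ≥ 2`; `(B, t, rank)` ranked
and full; `G` commutative.  For every plaquette `p'` there are integers `c_p`, independent of the
configuration, with `U_{p'} = ∏_{p∈B} U_p^{c_p}` for every `U`. [ours] -/
theorem exists_plaquetteHolonomy_eq_prod_zpow (hL : 2 ≤ L) (B : Finset (Plaquette d L))
    (t : Plaquette d L → Edge d L)
    (ht : ∀ p ∈ B, t p ∈ ({(p.1, p.2.1.1), (p.1.shift p.2.1.1, p.2.1.2),
        (p.1.shift p.2.1.2, p.2.1.1), (p.1, p.2.1.2)} : Finset (Edge d L)))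
    (rank : Plaquette d L → ℕ)
    (hrank : ∀ p ∈ B, ∀ p' ∈ B, p ≠ p' → t p ∈ ({(p'.1, p'.2.1.1), (p'.1.shift p'.2.1.1, p'.2.1.2),
        (p'.1.shift p'.2.1.2, p'.2.1.1), (p'.1, p'.2.1.2)} : Finset (Edge d L)) → rank p < rank p')
    (hcard : B.card = (d - 1) * (L ^ d - 1)) (p' : Plaquette d L) :
    ∃ c : Plaquette d L → ℤ, ∀ U : GaugeConfig d L G,
      plaquetteHolonomy U p'.1 p'.2.1.1 p'.2.1.2 = ∏ p ∈ B, (plaquetteHolonomy U p.1 p.2.1.1 p.2.1.2) ^ c p := by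
  obtain ⟨c, hc⟩ := exists_prod_zpow_eq_prod_plaquetteHolonomy_zpow (G := G) hL B t ht rank hrank hcard _
    (intDivergence_signedBoundary p') (funext fun m => intWinding_signedBoundary p' m)
  exact ⟨c, fun U => by rw [plaquetteHolonomy_eq_prod_zpow, hc U]⟩

/-- **The same for every OPTIMAL ranked structure** (`#Bᶜ = k_min(d, L) = (d−1)(d−2)/2·L^d + (d−1)`, the least
possible number of plaquettes outside, `TorusRankedMorseCount.isLeast_card_compl_ranked`). [ours] -/
theorem exists_plaquetteHolonomy_eq_prod_zpow_of_optimal (hL : 2 ≤ L) (B : Finset (Plaquette d L))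
    (t : Plaquette d L → Edge d L)
    (ht : ∀ p ∈ B, t p ∈ ({(p.1, p.2.1.1), (p.1.shift p.2.1.1, p.2.1.2),
        (p.1.shift p.2.1.2, p.2.1.1), (p.1, p.2.1.2)} : Finset (Edge d L)))
    (rank : Plaquette d L → ℕ)
    (hrank : ∀ p ∈ B, ∀ p' ∈ B, p ≠ p' → t p ∈ ({(p'.1, p'.2.1.1), (p'.1.shift p'.2.1.1, p'.2.1.2),
        (p'.1.shift p'.2.1.2, p'.2.1.1), (p'.1, p'.2.1.2)} : Finset (Edge d L)) → rank p < rank p')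
    (hopt : (Finset.univ \ B).card = (d - 1) * (d - 2) / 2 * L ^ d + (d - 1)) (p' : Plaquette d L) :
    ∃ c : Plaquette d L → ℤ, ∀ U : GaugeConfig d L G,
      plaquetteHolonomy U p'.1 p'.2.1.1 p'.2.1.2 = ∏ p ∈ B, (plaquetteHolonomy U p.1 p.2.1.1 p.2.1.2) ^ c p :=
  exists_plaquetteHolonomy_eq_prod_zpow hL B t ht rank hrank (card_eq_of_card_compl_eq_kmin B hopt) p'

/-! ## §4 Determination: the covered holonomies fix every holonomy -/

/-- **DETERMINATION.**  `L ≥ 2`; `(B, t, rank)` ranked and full; `G` commutative.  Two configurations with the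
same holonomy around every COVERED plaquette have the same holonomy around EVERY plaquette. [ours] -/
theorem plaquetteHolonomy_eq_of_covered_eq (hL : 2 ≤ L) (B : Finset (Plaquette d L))
    (t : Plaquette d L → Edge d L)
    (ht : ∀ p ∈ B, t p ∈ ({(p.1, p.2.1.1), (p.1.shift p.2.1.1, p.2.1.2),
        (p.1.shift p.2.1.2, p.2.1.1), (p.1, p.2.1.2)} : Finset (Edge d L)))
    (rank : Plaquette d L → ℕ)
    (hrank : ∀ p ∈ B, ∀ p' ∈ B, p ≠ p' → t p ∈ ({(p'.1, p'.2.1.1), (p'.1.shift p'.2.1.1, p'.2.1.2),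
        (p'.1.shift p'.2.1.2, p'.2.1.1), (p'.1, p'.2.1.2)} : Finset (Edge d L)) → rank p < rank p')
    (hcard : B.card = (d - 1) * (L ^ d - 1)) (U V : GaugeConfig d L G)
    (hcov : ∀ p ∈ B, plaquetteHolonomy U p.1 p.2.1.1 p.2.1.2 = plaquetteHolonomy V p.1 p.2.1.1 p.2.1.2) (p' : Plaquette d L) :
    plaquetteHolonomy U p'.1 p'.2.1.1 p'.2.1.2 = plaquetteHolonomy V p'.1 p'.2.1.1 p'.2.1.2 := by
  obtain ⟨c, hc⟩ := exists_plaquetteHolonomy_eq_prod_zpow (G := G) hL B t ht rank hrank hcard p'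
  rw [hc U, hc V]
  exact Finset.prod_congr rfl fun p hp => by rw [hcov p hp]

/-- **Hence every plaquette-weight product is a function of the covered holonomies** — in particular the
uncovered factor `F_R(U) = ∏_{p∉B} w(U_p)` of the exact sampler's importance ratio (take `S = Bᶜ`): along a
full ranked structure the one-plaquette heat-bath autoregression of an ABELIAN lattice gauge field leaves no
randomness to the plaquettes it does not cover. [ours] -/
theorem prod_weight_eq_of_covered_eq (hL : 2 ≤ L) (B : Finset (Plaquette d L))
    (t : Plaquette d L → Edge d L)
    (ht : ∀ p ∈ B, t p ∈ ({(p.1, p.2.1.1), (p.1.shift p.2.1.1, p.2.1.2),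
        (p.1.shift p.2.1.2, p.2.1.1), (p.1, p.2.1.2)} : Finset (Edge d L)))
    (rank : Plaquette d L → ℕ)
    (hrank : ∀ p ∈ B, ∀ p' ∈ B, p ≠ p' → t p ∈ ({(p'.1, p'.2.1.1), (p'.1.shift p'.2.1.1, p'.2.1.2),
        (p'.1.shift p'.2.1.2, p'.2.1.1), (p'.1, p'.2.1.2)} : Finset (Edge d L)) → rank p < rank p')
    (hcard : B.card = (d - 1) * (L ^ d - 1)) {α : Type*} [CommMonoid α] (w : G → α)
    (S : Finset (Plaquette d L)) (U V : GaugeConfig d L G)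
    (hcov : ∀ p ∈ B, plaquetteHolonomy U p.1 p.2.1.1 p.2.1.2 = plaquetteHolonomy V p.1 p.2.1.1 p.2.1.2) :
    ∏ p ∈ S, w (plaquetteHolonomy U p.1 p.2.1.1 p.2.1.2) = ∏ p ∈ S, w (plaquetteHolonomy V p.1 p.2.1.1 p.2.1.2) :=
  Finset.prod_congr rfl fun p _ => by
    rw [plaquetteHolonomy_eq_of_covered_eq hL B t ht rank hrank hcard U V hcov p]

/-- **The optimal form**: for every optimal ranked structure (`#Bᶜ = k_min(d, L)`) of an abelian lattice gauge
field, the covered holonomies determine all holonomies. [ours] -/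
theorem plaquetteHolonomy_eq_of_covered_eq_of_optimal (hL : 2 ≤ L) (B : Finset (Plaquette d L))
    (t : Plaquette d L → Edge d L)
    (ht : ∀ p ∈ B, t p ∈ ({(p.1, p.2.1.1), (p.1.shift p.2.1.1, p.2.1.2),
        (p.1.shift p.2.1.2, p.2.1.1), (p.1, p.2.1.2)} : Finset (Edge d L)))
    (rank : Plaquette d L → ℕ)
    (hrank : ∀ p ∈ B, ∀ p' ∈ B, p ≠ p' → t p ∈ ({(p'.1, p'.2.1.1), (p'.1.shift p'.2.1.1, p'.2.1.2),
        (p'.1.shift p'.2.1.2, p'.2.1.1), (p'.1, p'.2.1.2)} : Finset (Edge d L)) → rank p < rank p')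
    (hopt : (Finset.univ \ B).card = (d - 1) * (d - 2) / 2 * L ^ d + (d - 1)) (U V : GaugeConfig d L G)
    (hcov : ∀ p ∈ B, plaquetteHolonomy U p.1 p.2.1.1 p.2.1.2 = plaquetteHolonomy V p.1 p.2.1.1 p.2.1.2) (p' : Plaquette d L) :
    plaquetteHolonomy U p'.1 p'.2.1.1 p'.2.1.2 = plaquetteHolonomy V p'.1 p'.2.1.1 p'.2.1.2 :=
  plaquetteHolonomy_eq_of_covered_eq hL B t ht rank hrank (card_eq_of_card_compl_eq_kmin B hopt) U V hcov p'

/-! ## §5 The one relation that needs no structure: all plaquette holonomies multiply to `1` -/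

/-- **The signed boundaries of ALL plaquettes of `(ℤ/L)^d` sum to zero**: for each orientation `(i<j)` the
direction-`i` links enter as `𝟙_{(x,i)} − 𝟙_{(x+e_j,i)}` and the direction-`j` links as
`𝟙_{(x+e_i,j)} − 𝟙_{(x,j)}`, and `x ↦ x + e_j` (resp. `x + e_i`) is a bijection of the sites. [ours] -/
theorem sum_signedBoundary_eq_zero :
    ∑ p : Plaquette d L, (Pi.single (p.1, p.2.1.1) 1 + Pi.single (p.1.shift p.2.1.1, p.2.1.2) 1 -
        Pi.single (p.1.shift p.2.1.2, p.2.1.1) 1 - Pi.single (p.1, p.2.1.2) 1 : Edge d L → ℤ) = 0 := by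
  classical
  rw [Fintype.sum_prod_type, Finset.sum_comm]
  refine Finset.sum_eq_zero fun ij _ => ?_
  simp only [Finset.sum_add_distrib, Finset.sum_sub_distrib]
  have h1 : ∑ x : Site d L, (Pi.single (x.shift ij.1.2, ij.1.1) 1 : Edge d L → ℤ) =
      ∑ x : Site d L, (Pi.single (x, ij.1.1) 1 : Edge d L → ℤ) :=
    Fintype.sum_equiv (Equiv.addRight (Pi.single ij.1.2 (1 : ZMod L))) _ _ (fun x => rfl)
  have h2 : ∑ x : Site d L, (Pi.single (x.shift ij.1.1, ij.1.2) 1 : Edge d L → ℤ) =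
      ∑ x : Site d L, (Pi.single (x, ij.1.2) 1 : Edge d L → ℤ) :=
    Fintype.sum_equiv (Equiv.addRight (Pi.single ij.1.1 (1 : ZMod L))) _ _ (fun x => rfl)
  rw [h1, h2]
  abel

/-- **For commutative `G` the holonomies of ALL plaquettes multiply to `1`** (every `d`, every `L`). [ours] -/
theorem prod_plaquetteHolonomy_univ_eq_one (U : GaugeConfig d L G) :
    ∏ p : Plaquette d L, plaquetteHolonomy U p.1 p.2.1.1 p.2.1.2 = 1 := by
  have h := prod_zpow_sum_smul U (Finset.univ : Finset (Plaquette d L)) (fun _ => (1 : ℤ))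
    (fun p => (Pi.single (p.1, p.2.1.1) 1 + Pi.single (p.1.shift p.2.1.1, p.2.1.2) 1 -
        Pi.single (p.1.shift p.2.1.2, p.2.1.1) 1 - Pi.single (p.1, p.2.1.2) 1 : Edge d L → ℤ))
  simp only [one_smul, zpow_one, sum_signedBoundary_eq_zero, Pi.zero_apply, zpow_zero,
    Finset.prod_const_one] at h
  rw [h]
  exact Finset.prod_congr rfl fun p _ => plaquetteHolonomy_eq_prod_zpow U p

/-- **Hence any one plaquette holonomy is the inverse product of all the others** (every `d`; the
two-dimensional case is `Theory2.Lattice.TwoDim.plaquetteHolonomy_eq_inv_prod_erase` of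
`PlaquetteMarginals2D`) — in TWO dimensions, where a full ranked structure leaves exactly ONE plaquette `p₀`
outside (`k_min(2, L) = 1`: the comb of `AutoregressiveGaugeHeatBathComb`, the Morse structure), this is the
whole determination: `U_{p₀} = (∏_{p ≠ p₀} U_p)⁻¹`, every exponent `−1`. [ours] -/
theorem plaquetteHolonomy_eq_inv_prod_erase_anyDim (U : GaugeConfig d L G) (p₀ : Plaquette d L) :
    plaquetteHolonomy U p₀.1 p₀.2.1.1 p₀.2.1.2 =
      (∏ p ∈ Finset.univ.erase p₀, plaquetteHolonomy U p.1 p.2.1.1 p.2.1.2)⁻¹ := by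
  classical
  have h := prod_plaquetteHolonomy_univ_eq_one U
  rw [← Finset.mul_prod_erase Finset.univ _ (Finset.mem_univ p₀)] at h
  exact eq_inv_of_mul_eq_one_left h

end Summit.Ventures.LatticeQCDFlow.Theory2.Autoregressive
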